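import Mathlib.Analysis.ODE.PicardLindelof
import Mathlib.Analysis.SpecialFunctions.SmoothTransition
import Summits.NavierStokesRegularity.FluidComputer.BlockPairStall

/-!
# Block design — the pair field's exact orbits EXIST on every tick (global forward existence)
(bp3 gen 36, ASSEMBLY §2g.9(s); restaged gen 41 as ASK 107′ with one duplicated elementary helper inlined;
discharges the standing hypothesis "an exact orbit on `[0, T]`"
of `BlockPairStall` / `BlockPairCeiling` / `BlockPairTransit` / `BlockPairHandoff`)

HONEST FRAMING: low prior, high value-of-information experiment on Tao's machine paradigm; NOT a
claim that NS blows up. Design level only: nothing in this file is a statement about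
Navier–Stokes; it is the classical well-posedness of ONE planar polynomial ODE.

The orbit theorems of the pair field `pairVF Λ₁ Λ₂ η k k'` (viscous ceiling and stall, ASK 102;
no reach certificate below the supercritical threshold, ASK 103; exact-orbit hand-off at small
damping, ASKs 105/106) are all stated FOR EVERY exact orbit `z` on a tick,
`ContinuousOn z (Icc 0 T)` with right derivatives `pairVF … (z t)` on `Ico 0 T`. This file
proves that such an orbit EXISTS from EVERY initial readout `z₀ : ℝ × ℝ`, on every `[0, T]`,
whenever `Λ₁, Λ₂ ≥ 0` and `η > 0` (`pair_orbit_exists`), so those theorems are not vacuous and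
the design's exact two-mode dynamics is an honest object: from the clean input `(A₀, 0)` THE
orbit exists, stalls below the threshold (`pair_orbit_exists_stalls`, with ASK 102), and — by
ASK 106, not imported here — hands off at damping `≤ 1/20`.

THE PRINTED ARGUMENT, followed literally [cite: RobinsonRodrigoSadowski2016, Thm. 4.4 Steps 1–2]
(the Galerkin case; the same device is formalised for the truncated Navier–Stokes system in
`Literature/…/GalerkinExistence`): the field is a polynomial, hence `C¹`; the pair energy
`E = a² + η b²` satisfies `dE/dt = -2(Λ₁ a² + η Λ₂ b²) ≤ 0` along orbits (`pairVF_energy`: the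
exchange AND the backscatter terms cancel), so orbits stay in the compact sublevel set
`{E ≤ E(z₀)}` (`η > 0`). Bookkeeping device: multiply the field by a `C¹` cutoff
`χ(E/ρ)` (`χ = 1` on `E ≤ ρ`, `χ = 0` on `E ≥ 2ρ`, `ρ = E(z₀) + 1`); the cut field is globally
Lipschitz and bounded (`C¹` with compact support), so ONE application of Mathlib's
Picard–Lindelöf theorem (`IsPicardLindelof`, ball radius `M T + 1`) solves the CUT system on the
whole of `[0, T]`; along that solution the energy is still non-increasing (the cutoff factor is
`≥ 0`), so `E ≤ E(z₀) < ρ`, the cutoff is never active, and the solution solves the TRUE system.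

Main declarations: `contDiff_pairVF`, `contDiff_pairEnergy`, `ecut` (+ lemmas), `cutVF`,
`cutVF_eq_zero`, `cutVF_eq_of_le`, `isCompact_pairEnergy_le`, `exists_lipschitzWith_cutVF`,
`exists_bound_cutVF`, `exists_solution_cutVF`, `orbit_of_Icc`, `cut_energy_le`,
**`pair_orbit_exists`**, `pair_orbit_exists_stalls`, and the flow selection `pairFlow`
(+ `pairFlow_zero`, `continuousOn_pairFlow`, `hasDerivWithinAt_pairFlow`: literally the `flow_*`
inputs of `Literature…ReachCertificate.ofFlow`, for a future certificate on a BOUNDED region).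
Uniqueness and continuous dependence are not needed by the lane and not recorded.
[folklore]
-/

open Set Filter Topology Metric NNReal

namespace Summit.NavierStokesRegularity.FluidComputer

open Literature.Analysis.FluidPDE Literature.Analysis.FluidPDE.FluidComputer

namespace BlockDesign

/-! ## Smoothness of the field and of the energy -/

/-- The pair field is `C¹` (a polynomial map `ℝ² → ℝ²`). [folklore] -/
theorem contDiff_pairVF (Λ₁ Λ₂ η k k' : ℝ) : ContDiff ℝ 1 (pairVF Λ₁ Λ₂ η k k') := by
  unfold pairVF; fun_prop

/-- The pair energy is `C¹`. [folklore] -/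
theorem contDiff_pairEnergy (η : ℝ) : ContDiff ℝ 1 (pairEnergy η) := by
  unfold pairEnergy; fun_prop

/-- The pair energy is continuous. [folklore] -/
theorem continuous_pairEnergy (η : ℝ) : Continuous (pairEnergy η) :=
  (contDiff_pairEnergy η).continuous

/-! ## The cutoff and the cut field -/

/-- A `C¹` cutoff: `χ = 1` on `(-∞, 1]`, `χ = 0` on `[2, ∞)`, `χ ≥ 0`. [folklore] -/
noncomputable def ecut (u : ℝ) : ℝ := Real.smoothTransition (2 - u)

/-- `χ(u) = 1` for `u ≤ 1`. [folklore] -/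
theorem ecut_of_le_one {u : ℝ} (h : u ≤ 1) : ecut u = 1 :=
  Real.smoothTransition.one_of_one_le (by linarith)

/-- `χ(u) = 0` for `u ≥ 2`. [folklore] -/
theorem ecut_of_two_le {u : ℝ} (h : 2 ≤ u) : ecut u = 0 :=
  Real.smoothTransition.zero_of_nonpos (by linarith)

/-- `χ ≥ 0`. [folklore] -/
theorem ecut_nonneg (u : ℝ) : 0 ≤ ecut u := Real.smoothTransition.nonneg _

/-- `χ` is `C¹`. [folklore] -/
theorem contDiff_ecut : ContDiff ℝ 1 ecut :=
  Real.smoothTransition.contDiff.comp (contDiff_const.sub contDiff_id)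

/-- The ENERGY-CUT pair field `χ(E(z)/ρ) · pairVF(z)`. [folklore] -/
noncomputable def cutVF (Λ₁ Λ₂ η k k' ρ : ℝ) (z : ℝ × ℝ) : ℝ × ℝ :=
  ecut (pairEnergy η z / ρ) • pairVF Λ₁ Λ₂ η k k' z

section Cut

variable {Λ₁ Λ₂ η k k' ρ T : ℝ}

/-- The cut field is `C¹`. [folklore] -/
theorem contDiff_cutVF (Λ₁ Λ₂ η k k' ρ : ℝ) : ContDiff ℝ 1 (cutVF Λ₁ Λ₂ η k k' ρ) := by
  unfold cutVF
  exact (contDiff_ecut.comp ((contDiff_pairEnergy η).div_const ρ)).smul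
    (contDiff_pairVF Λ₁ Λ₂ η k k')

/-- The cut field VANISHES where `E ≥ 2ρ` (`ρ > 0`). [folklore] -/
theorem cutVF_eq_zero (hρ : 0 < ρ) {z : ℝ × ℝ} (h : 2 * ρ ≤ pairEnergy η z) :
    cutVF Λ₁ Λ₂ η k k' ρ z = 0 := by
  unfold cutVF
  rw [ecut_of_two_le, zero_smul]
  rwa [le_div_iff₀ hρ]

/-- The cut field IS the pair field where `E ≤ ρ` (`ρ > 0`). [folklore] -/
theorem cutVF_eq_of_le (hρ : 0 < ρ) {z : ℝ × ℝ} (h : pairEnergy η z ≤ ρ) :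
    cutVF Λ₁ Λ₂ η k k' ρ z = pairVF Λ₁ Λ₂ η k k' z := by
  unfold cutVF
  rw [ecut_of_le_one, one_smul]
  rwa [div_le_one hρ]

/-- For `η > 0` the energy sublevel sets `{E ≤ c}` are COMPACT (closed and bounded in `ℝ²`).
[folklore] -/
theorem isCompact_pairEnergy_le (hη : 0 < η) (c : ℝ) :
    IsCompact {z : ℝ × ℝ | pairEnergy η z ≤ c} := by
  refine isCompact_of_isClosed_isBounded
    (isClosed_le (continuous_pairEnergy η) continuous_const) ?_
  refine (isBounded_closedBall (x := (0 : ℝ × ℝ)) (r := |c| + |c| / η + 2)).subset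
    fun z hz => ?_
  have hE : z.1 ^ 2 + η * z.2 ^ 2 ≤ c := hz
  have hc : 0 ≤ |c| / η := div_nonneg (abs_nonneg c) hη.le
  have ha : z.1 ^ 2 ≤ |c| := by nlinarith [le_abs_self c, mul_nonneg hη.le (sq_nonneg z.2)]
  have hb : z.2 ^ 2 ≤ |c| / η := by
    rw [le_div_iff₀ hη]; nlinarith [le_abs_self c, sq_nonneg z.1]
  -- `|x| ≤ x² + 1` for both coordinates, inlined (the named helper of the gen-36 draft restated the
  -- landed `Literature.Probability.RandomMatrixProducts.abs_le_sq_add_one`; gate preflight `dedup.landed`).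
  have h1 : |z.1| ≤ z.1 ^ 2 + 1 := by
    rcases abs_cases z.1 with ⟨h, _⟩ | ⟨h, _⟩ <;> rw [h] <;>
      nlinarith [sq_nonneg (z.1 - 1), sq_nonneg (z.1 + 1)]
  have h2 : |z.2| ≤ z.2 ^ 2 + 1 := by
    rcases abs_cases z.2 with ⟨h, _⟩ | ⟨h, _⟩ <;> rw [h] <;>
      nlinarith [sq_nonneg (z.2 - 1), sq_nonneg (z.2 + 1)]
  rw [mem_closedBall_zero_iff, Prod.norm_def, Real.norm_eq_abs, Real.norm_eq_abs]
  exact max_le (by nlinarith [h1, abs_nonneg c]) (by nlinarith [h2, abs_nonneg c])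

/-- **The cut field is globally LIPSCHITZ** (`C¹`; its derivative is bounded on the compact set
`{E ≤ 3ρ}` and vanishes outside it). [folklore] -/
theorem exists_lipschitzWith_cutVF (hη : 0 < η) (hρ : 0 < ρ) :
    ∃ K : ℝ≥0, LipschitzWith K (cutVF Λ₁ Λ₂ η k k' ρ) := by
  have hcd := contDiff_cutVF Λ₁ Λ₂ η k k' ρ
  have hcont : Continuous (fderiv ℝ (cutVF Λ₁ Λ₂ η k k' ρ)) :=
    hcd.continuous_fderiv one_ne_zero
  obtain ⟨C, hC⟩ :=
    (isCompact_pairEnergy_le hη (3 * ρ)).exists_bound_of_continuousOn hcont.continuousOn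
  refine ⟨⟨max C 0, le_max_right _ _⟩,
    lipschitzWith_of_nnnorm_fderiv_le (hcd.differentiable one_ne_zero) fun p => ?_⟩
  rw [← NNReal.coe_le_coe, coe_nnnorm]
  by_cases hp : pairEnergy η p ≤ 3 * ρ
  · exact (hC p hp).trans (le_max_left _ _)
  · rw [not_le] at hp
    have hev : cutVF Λ₁ Λ₂ η k k' ρ =ᶠ[𝓝 p] fun _ => 0 := by
      have ho : IsOpen {q : ℝ × ℝ | 2 * ρ < pairEnergy η q} :=
        isOpen_lt continuous_const (continuous_pairEnergy η)
      filter_upwards [ho.mem_nhds (show 2 * ρ < pairEnergy η p by linarith)] with q hq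
      exact cutVF_eq_zero hρ (le_of_lt hq)
    rw [hev.fderiv_eq, fderiv_const_apply, norm_zero]
    exact le_max_right _ _

/-- The cut field is BOUNDED. [folklore] -/
theorem exists_bound_cutVF (hη : 0 < η) (hρ : 0 < ρ) :
    ∃ M : ℝ, 0 ≤ M ∧ ∀ p, ‖cutVF Λ₁ Λ₂ η k k' ρ p‖ ≤ M := by
  obtain ⟨C, hC⟩ := (isCompact_pairEnergy_le hη (2 * ρ)).exists_bound_of_continuousOn
    (contDiff_cutVF Λ₁ Λ₂ η k k' ρ).continuous.continuousOn
  refine ⟨max C 0, le_max_right _ _, fun p => ?_⟩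
  by_cases hp : pairEnergy η p ≤ 2 * ρ
  · exact (hC p hp).trans (le_max_left _ _)
  · rw [not_le] at hp
    rw [cutVF_eq_zero hρ hp.le, norm_zero]
    exact le_max_right _ _

/-! ## Picard–Lindelöf on the whole tick in one step -/

/-- **A solution of the CUT system on `[0, T]` from any datum** (globally Lipschitz, bounded
field; one application of `IsPicardLindelof` with ball radius `M T + 1`).
[cite: RobinsonRodrigoSadowski2016, Thm. 4.4 Step 1] -/
theorem exists_solution_cutVF (hη : 0 < η) (hρ : 0 < ρ) (hT : 0 < T) (z₀ : ℝ × ℝ) :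
    ∃ α : ℝ → ℝ × ℝ, α 0 = z₀ ∧
      ∀ t ∈ Icc 0 T, HasDerivWithinAt α (cutVF Λ₁ Λ₂ η k k' ρ (α t)) (Icc 0 T) t := by
  obtain ⟨K, hK⟩ := exists_lipschitzWith_cutVF (Λ₁ := Λ₁) (Λ₂ := Λ₂) (k := k) (k' := k') hη hρ
  obtain ⟨C, hC0, hC⟩ := exists_bound_cutVF (Λ₁ := Λ₁) (Λ₂ := Λ₂) (k := k) (k' := k') hη hρ
  have t0mem : (0 : ℝ) ∈ Icc (0 : ℝ) T := ⟨le_rfl, hT.le⟩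
  set L : ℝ≥0 := ⟨C, hC0⟩ with hL
  set a : ℝ≥0 := ⟨C * T + 1, by nlinarith [hC0, hT.le]⟩ with ha
  have hpl : IsPicardLindelof (fun _ : ℝ => cutVF Λ₁ Λ₂ η k k' ρ) (⟨0, t0mem⟩ : Icc (0 : ℝ) T)
      z₀ a 0 L K :=
    { lipschitzOnWith := fun _ _ => hK.lipschitzOnWith
      continuousOn := fun _ _ => continuousOn_const
      norm_le := fun _ _ x _ => hC x
      mul_max_le := by
        show (C : ℝ) * max (T - 0) (0 - 0) ≤ (C * T + 1 : ℝ) - 0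
        rw [sub_zero, sub_self, max_eq_left hT.le, sub_zero]
        linarith }
  exact hpl.exists_eq_forall_mem_Icc_hasDerivWithinAt₀

/-- A curve with derivatives within `Icc 0 T` is an orbit in the lane's format: continuous on
`Icc 0 T` with RIGHT derivatives on `Ico 0 T`. [folklore] -/
theorem orbit_of_Icc {F : ℝ × ℝ → ℝ × ℝ} {α : ℝ → ℝ × ℝ}
    (hα : ∀ t ∈ Icc 0 T, HasDerivWithinAt α (F (α t)) (Icc 0 T) t) :
    ContinuousOn α (Icc 0 T) ∧ ∀ t ∈ Ico 0 T, HasDerivWithinAt α (F (α t)) (Ici t) t :=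
  ⟨fun t ht => (hα t ht).continuousWithinAt,
    fun t ht => (hα t (Ico_subset_Icc_self ht)).mono_of_mem_nhdsWithin
      (mem_of_superset (Icc_mem_nhdsGE ht.2) (Icc_subset_Icc ht.1 le_rfl))⟩

/-- The energy is NON-INCREASING along orbits of the CUT system too (the cutoff factor is
`≥ 0`; `Λ₁, Λ₂, η ≥ 0`). [folklore] -/
theorem cut_energy_le (hΛ₁ : 0 ≤ Λ₁) (hΛ₂ : 0 ≤ Λ₂) (hη : 0 ≤ η) {α : ℝ → ℝ × ℝ}
    (hcont : ContinuousOn α (Icc 0 T))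
    (hderiv : ∀ t ∈ Ico 0 T, HasDerivWithinAt α (cutVF Λ₁ Λ₂ η k k' ρ (α t)) (Ici t) t) :
    ∀ t ∈ Icc 0 T, pairEnergy η (α t) ≤ pairEnergy η (α 0) := by
  have hf := continuousOn_pairEnergy_comp hcont η
  have hf' := fun x (hx : x ∈ Ico 0 T) => hasDerivWithinAt_pairEnergy_comp (hderiv x hx) η
  intro t ht
  refine image_le_of_deriv_right_le_deriv_boundary hf hf' (B := fun _ => pairEnergy η (α 0))
    (B' := fun _ => 0) le_rfl (fun _ _ => continuousWithinAt_const)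
    (fun _ _ => hasDerivWithinAt_const _ _ _) (fun x _ => ?_) ht
  have hc := ecut_nonneg (pairEnergy η (α x) / ρ)
  have key := pairVF_energy Λ₁ Λ₂ η k k' (α x)
  simp only [cutVF, Prod.smul_fst, Prod.smul_snd, smul_eq_mul]
  nlinarith [mul_nonneg hc (mul_nonneg hΛ₁ (sq_nonneg (α x).1)),
    mul_nonneg hc (mul_nonneg (mul_nonneg hη hΛ₂) (sq_nonneg (α x).2))]

/-! ## Global forward existence for the pair field -/

/-- **EXACT ORBITS EXIST ON EVERY TICK.** For `Λ₁, Λ₂ ≥ 0`, `η > 0` and ANY `k, k'`, from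
every initial readout `z₀` and on every `[0, T]` there is an orbit of the pair field in the
lane's format: `z 0 = z₀`, `z` continuous on `Icc 0 T`, right derivative `pairVF … (z t)` at
every `t ∈ Ico 0 T` (indeed the derivative within `Icc 0 T` on all of `Icc 0 T`).
[cite: RobinsonRodrigoSadowski2016, Thm. 4.4 Steps 1–2] -/
theorem pair_orbit_exists (hΛ₁ : 0 ≤ Λ₁) (hΛ₂ : 0 ≤ Λ₂) (hη : 0 < η) (k k' : ℝ) (hT : 0 < T)
    (z₀ : ℝ × ℝ) :
    ∃ z : ℝ → ℝ × ℝ, z 0 = z₀ ∧ ContinuousOn z (Icc 0 T) ∧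
      (∀ t ∈ Icc 0 T, HasDerivWithinAt z (pairVF Λ₁ Λ₂ η k k' (z t)) (Icc 0 T) t) ∧
      ∀ t ∈ Ico 0 T, HasDerivWithinAt z (pairVF Λ₁ Λ₂ η k k' (z t)) (Ici t) t := by
  set ρ : ℝ := pairEnergy η z₀ + 1 with hρdef
  have hρ : 0 < ρ := by have := pairEnergy_nonneg hη.le z₀; linarith
  obtain ⟨α, h0, hα⟩ := exists_solution_cutVF (Λ₁ := Λ₁) (Λ₂ := Λ₂) (k := k) (k' := k') hη hρ hT z₀
  obtain ⟨hcont, hder⟩ := orbit_of_Icc hα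
  have hE := cut_energy_le hΛ₁ hΛ₂ hη.le hcont hder
  have htrue : ∀ t ∈ Icc 0 T, cutVF Λ₁ Λ₂ η k k' ρ (α t) = pairVF Λ₁ Λ₂ η k k' (α t) :=
    fun t ht => cutVF_eq_of_le hρ (by have := hE t ht; rw [h0] at this; linarith)
  have hα' : ∀ t ∈ Icc 0 T, HasDerivWithinAt α (pairVF Λ₁ Λ₂ η k k' (α t)) (Icc 0 T) t :=
    fun t ht => htrue t ht ▸ hα t ht
  exact ⟨α, h0, hcont, hα', (orbit_of_Icc hα').2⟩

/-- **THE DESIGN'S EXACT DYNAMICS STALLS BELOW THE THRESHOLD** (with ASK 102): from the clean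
input `(A₀, 0)`, `A₀ > 0`, the orbit on `[0, T]` EXISTS, and every such orbit keeps its output
amplitude `< A₀` when the block is subcritical, `k A₀ ≤ Λ₂` (`k > 0`, `k' = 0`, `η > 0`,
`Λ₁ ≥ 0`). [folklore] -/
theorem pair_orbit_exists_stalls (hΛ₁ : 0 ≤ Λ₁) (hη : 0 < η) (hk : 0 < k) (hT : 0 < T)
    {A₀ : ℝ} (hA₀ : 0 < A₀) (hsub : k * A₀ ≤ Λ₂) :
    (∃ z : ℝ → ℝ × ℝ, z 0 = (A₀, 0) ∧ ContinuousOn z (Icc 0 T) ∧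
      ∀ t ∈ Ico 0 T, HasDerivWithinAt z (pairVF Λ₁ Λ₂ η k 0 (z t)) (Ici t) t) ∧
    ∀ z : ℝ → ℝ × ℝ, z 0 = (A₀, 0) → ContinuousOn z (Icc 0 T) →
      (∀ t ∈ Ico 0 T, HasDerivWithinAt z (pairVF Λ₁ Λ₂ η k 0 (z t)) (Ici t) t) →
      ∀ t ∈ Icc 0 T, (z t).2 < A₀ := by
  have hΛ₂ : 0 < Λ₂ := lt_of_lt_of_le (mul_pos hk hA₀) hsub
  refine ⟨?_, fun z h0 hcont hderiv => ?_⟩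
  · obtain ⟨z, h0, hcont, -, hder⟩ := pair_orbit_exists hΛ₁ hΛ₂.le hη k 0 hT (A₀, 0)
    exact ⟨z, h0, hcont, hder⟩
  · have h1 : (z 0).1 = A₀ := by rw [h0]
    have h2 : (z 0).2 = 0 := by rw [h0]
    intro t ht
    have h := pair_snd_lt_of_subcritical hΛ₁ hΛ₂ hη.le hk le_rfl (by rw [h1]; exact hsub)
      hcont hderiv (by rw [h1]; exact hA₀) h2 t ht
    rwa [h1] at h

/-! ## A flow selection in the format of `ReachCertificate.ofFlow` -/

/-- A FLOW SELECTION for the pair field on the tick `[0, T]`: for each initial readout `p` one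
exact orbit from `p` (by choice from `pair_orbit_exists`; uniqueness is not needed). Its three
properties below are literally the `flow_zero` / `flow_cont` / `flow_deriv` inputs of
`Literature…ReachCertificate.ofFlow`. [folklore] -/
noncomputable def pairFlow (hΛ₁ : 0 ≤ Λ₁) (hΛ₂ : 0 ≤ Λ₂) (hη : 0 < η) (k k' : ℝ)
    (hT : 0 < T) : ℝ → ℝ × ℝ → ℝ × ℝ :=
  fun σ p => (pair_orbit_exists hΛ₁ hΛ₂ hη k k' hT p).choose σ

/-- The selected orbit starts at `p`. [folklore] -/
theorem pairFlow_zero (hΛ₁ : 0 ≤ Λ₁) (hΛ₂ : 0 ≤ Λ₂) (hη : 0 < η) (k k' : ℝ) (hT : 0 < T)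
    (p : ℝ × ℝ) : pairFlow hΛ₁ hΛ₂ hη k k' hT 0 p = p :=
  (pair_orbit_exists hΛ₁ hΛ₂ hη k k' hT p).choose_spec.1

/-- The selected orbit is continuous on the tick. [folklore] -/
theorem continuousOn_pairFlow (hΛ₁ : 0 ≤ Λ₁) (hΛ₂ : 0 ≤ Λ₂) (hη : 0 < η) (k k' : ℝ)
    (hT : 0 < T) (p : ℝ × ℝ) :
    ContinuousOn (fun σ => pairFlow hΛ₁ hΛ₂ hη k k' hT σ p) (Icc 0 T) :=
  (pair_orbit_exists hΛ₁ hΛ₂ hη k k' hT p).choose_spec.2.1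

/-- The selected orbit solves the pair field (right derivatives on `Ico 0 T`). [folklore] -/
theorem hasDerivWithinAt_pairFlow (hΛ₁ : 0 ≤ Λ₁) (hΛ₂ : 0 ≤ Λ₂) (hη : 0 < η) (k k' : ℝ)
    (hT : 0 < T) (p : ℝ × ℝ) :
    ∀ σ ∈ Ico 0 T, HasDerivWithinAt (fun σ' => pairFlow hΛ₁ hΛ₂ hη k k' hT σ' p)
      (pairVF Λ₁ Λ₂ η k k' (pairFlow hΛ₁ hΛ₂ hη k k' hT σ p)) (Ici σ) σ :=
  (pair_orbit_exists hΛ₁ hΛ₂ hη k k' hT p).choose_spec.2.2.2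

end Cut

end BlockDesign

end Summit.NavierStokesRegularity.FluidComputer
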